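import Summits.ResolutionOfSingularities.ResolutionOfSingularities.Theorems.HilbertSamuelEliminationSigmaMaxModificationsCorridor3WLadderIsoTailsFormalFrameTower
import HarnessLib

/-!
# [OURS · L1 W4.2 · D14 ROUTE H/G «K1 FREE-RATIONAL TAILS»] G1a-1b: POINT UNIQUENESS in the `t`-chart
# (the `κ`-rational point `(t, r_k/t − ã_k)` of `R[𝔪/t]` is cut out by ANY proper ideal containing its equations; crux
# `SigmaMaxModifications` stmt-ResolutionOfSingularities-18506 / conjunct stmt-…-19249; kernel `IsoQuadraticTowerTerminates p 3`, card C5 K1)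

Prover res-type-038 (gen 21), sequel of the base frame `…IsoTailsFormalFrameBase` (p525909) on res-L1-w42-lead-1's CUT G1a
(2026-08-27T10:43:09Z); INPUT for the G1a-2 TOWER ASSEMBLY holder (res-L1-w42-plan-1 RULINGS v3.14-14 (DN) / v3.14-15 (DT)).
Helper file `--supports stmt-ResolutionOfSingularities-19249 --as helper`; kernel only, def-free, no named fact. OURS (cell res-hironaka,
slot W4.2); NOT statements of [Hironaka2017] nor of [CossartJannsenSaito2020] / [CossartPiltant2009]. AI-written; AI review is weaker
than expert review.

## What is proved

Let `(R, 𝔪)` be local with `𝔪 = (r_0, …, r_{d−1})`, `t := r j`, and let `ã : Fin d → R` be arbitrary lifts. In the affine blowup algebra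
`B := R[𝔪/t]` (tree `blowupAlgebra (maximalIdeal R) t`, Görtz–Wedhorn (13.19)) put `g_k := r_k/t − ã_k` (`k ≠ j`).

* `exists_sub_algebraMap_mem_of_gens_mem` — **every element of `B` is congruent to an element of `R` modulo ANY ideal `J ∋ g_k`** (`t/t = 1`):
  `∀ b, ∃ r₀ : R, b − r₀ ∈ J`. (Adjoin induction on the generators `x/t`, `x ∈ 𝔪`: writing `x = Σ a_k r_k` gives
  `x/t = Σ a_k · (r_k/t) ≡ Σ a_k e_k` with `e_j = 1`, `e_k = ã_k`.)
* `mem_of_sub_algebraMap_mem` — if moreover `r₀ ∈ 𝔪` then `b ∈ J` (`𝔪 B = t B ⊆ J`, Stacks 07Z3 (2)).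
* `isMaximal_of_gens_mem`, `le_of_gens_mem`, `eq_of_gens_mem` — hence every PROPER ideal containing `t` and the `g_k` is MAXIMAL, and
  ALL SUCH IDEALS COINCIDE: the `κ`-rational point `(t, r_k/t − ã_k)` of the `t`-chart is ONE closed point, whichever proper ideal
  presents it.
* `stepPrime_eq_of_gens_mem` (`d = 4`, `j = 0`, lead-1's frames) — res-type-071's maximal ideal `𝔑 ∋ t/1, r_i/t − ã_i/1`
  (`EmbeddedStep.exists_maximalIdeal_presentation`, p525782) EQUALS lead-1's `FormalFrame.stepPrime c hψt` for the matching constants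
  `c_i = res(ψ ã_i) − λ_i` (`t_mem_stepPrime`, `span_le_stepPrime`, p524558) — the `hle` of `eq_stepPrime_of_isMaximal_of_le` comes for
  free, and NO residue-surjectivity of `ψ` is needed for the matching; `isLocalizationAtPrime_stepPrime_of_eq` transports the tower's
  instance `IsLocalization.AtPrime (R (n+1)) 𝔑` to `stepPrime c hψt`, so that `FormalFrame.stepFrame c hψt (R (n+1))` is available
  on res-type-071's ring.

References: U. Görtz, T. Wedhorn, *Algebraic Geometry I* (2nd ed. 2020), (13.19) p. 415 [GortzWedhorn2020]; The Stacks Project,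
Tag 07Z3 (2) [StacksProject].
-/

noncomputable section

set_option linter.dupNamespace false -- mandated namespace of this single-conjunct summit

open MvPowerSeries IsLocalRing
open Literature.AlgebraicGeometry.Resolution

namespace Summit.ResolutionOfSingularities.ResolutionOfSingularities.Cruxes.SigmaMaxModifications.IdeasL1C5

universe u

namespace FormalFrame

/-! ### §1. Every element of `R[𝔪/t]` is congruent to a scalar modulo the point's equations -/

section Point

variable {R : Type u} [CommRing R] [IsLocalRing R] {d : ℕ} (r : Fin d → R)
  (hspan : Ideal.span (Set.range r) = maximalIdeal R) (j : Fin d) {t : R} (ht : r j = t)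
  (hr : ∀ k, k ≠ j → r k ∈ maximalIdeal R) (at_ : Fin d → R)

/-- `t/t = 1` in `R[𝔪/t]`. [folklore] -/
theorem div_self_eq_one (htm : t ∈ maximalIdeal R) :
    (⟨_, div_mem_blowupAlgebra (maximalIdeal R) t htm⟩ : blowupAlgebra (maximalIdeal R) t) = 1 :=
  Subtype.ext (IsLocalization.Away.mul_invSelf t)

include hspan ht in
/-- **Every element of `B = R[𝔪/t]` is congruent to an element of `R` modulo any ideal containing the
`g_k = r_k/t − ã_k` (`k ≠ j`)** (`t` itself is not needed: `t/t = 1`). Adjoin induction on the generators `x/t`, `x ∈ 𝔪 = (r_k)`: `x = Σ a_k r_k` gives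
`x/t = Σ_k a_k (r_k/t) ≡ a_j + Σ_{k≠j} a_k ã_k`. [cite: GortzWedhorn2020, (13.19) p. 415] -/
theorem exists_sub_algebraMap_mem_of_gens_mem (J : Ideal (blowupAlgebra (maximalIdeal R) t))
    (hJg : ∀ k (hk : k ≠ j), (⟨_, div_mem_blowupAlgebra (maximalIdeal R) t (hr k hk)⟩ -
      algebraMap R (blowupAlgebra (maximalIdeal R) t) (at_ k) : blowupAlgebra (maximalIdeal R) t) ∈ J)
    (b : blowupAlgebra (maximalIdeal R) t) :
    ∃ r₀ : R, b - algebraMap R (blowupAlgebra (maximalIdeal R) t) r₀ ∈ J := by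
  classical
  have hrm : ∀ k, r k ∈ maximalIdeal R := fun k => hspan ▸ Ideal.subset_span ⟨k, rfl⟩
  -- the point's equations at EVERY index: `δ_k := r_k/t − e_k ∈ J` with `e_j = 1`, `e_k = ã_k`
  let e : Fin d → R := fun k => if k = j then 1 else at_ k
  have hδ : ∀ k, (⟨_, div_mem_blowupAlgebra (maximalIdeal R) t (hrm k)⟩ -
      algebraMap R (blowupAlgebra (maximalIdeal R) t) (e k) : blowupAlgebra (maximalIdeal R) t) ∈ J := by
    intro k
    by_cases hk : k = j
    · have h1 : (⟨_, div_mem_blowupAlgebra (maximalIdeal R) t (hrm k)⟩ : blowupAlgebra (maximalIdeal R) t) = 1 := by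
        apply Subtype.ext
        show algebraMap R (Localization.Away t) (r k) * IsLocalization.Away.invSelf t = 1
        rw [hk, ht]
        exact IsLocalization.Away.mul_invSelf t
      simp only [e, if_pos hk, map_one]
      rw [h1, sub_self]
      exact J.zero_mem
    · simp only [e, if_neg hk]
      exact hJg k hk
  -- adjoin induction
  suffices key : ∀ (y : Localization.Away t) (hy : y ∈ blowupAlgebra (maximalIdeal R) t),
      ∃ r₀ : R, (⟨y, hy⟩ : blowupAlgebra (maximalIdeal R) t) -
        algebraMap R (blowupAlgebra (maximalIdeal R) t) r₀ ∈ J from key b b.2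
  intro y hy
  induction hy using Algebra.adjoin_induction with
  | mem y hy =>
    obtain ⟨x, hx, rfl⟩ := hy
    -- `x = Σ a_k r_k`
    have hx' : x ∈ Ideal.span (Set.range r) := hspan ▸ hx
    obtain ⟨a, ha⟩ := Ideal.mem_span_range_iff_exists_fun.mp hx'
    refine ⟨∑ k, a k * e k, ?_⟩
    -- `x/t − Σ a_k e_k = Σ a_k · δ_k`
    have hsum : (⟨_, div_mem_blowupAlgebra (maximalIdeal R) t hx⟩ : blowupAlgebra (maximalIdeal R) t) -
        algebraMap R (blowupAlgebra (maximalIdeal R) t) (∑ k, a k * e k) =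
        ∑ k, algebraMap R (blowupAlgebra (maximalIdeal R) t) (a k) *
          ((⟨_, div_mem_blowupAlgebra (maximalIdeal R) t (hrm k)⟩ : blowupAlgebra (maximalIdeal R) t) -
            algebraMap R (blowupAlgebra (maximalIdeal R) t) (e k)) := by
      have hxt : (⟨_, div_mem_blowupAlgebra (maximalIdeal R) t hx⟩ : blowupAlgebra (maximalIdeal R) t) =
          ∑ k, algebraMap R (blowupAlgebra (maximalIdeal R) t) (a k) *
            (⟨_, div_mem_blowupAlgebra (maximalIdeal R) t (hrm k)⟩ : blowupAlgebra (maximalIdeal R) t) := by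
        apply Subtype.ext
        simp only [← ha, map_sum, map_mul, Finset.sum_mul]
        push_cast
        refine Finset.sum_congr rfl fun k _ => ?_
        ring
      rw [hxt, map_sum, ← Finset.sum_sub_distrib]
      refine Finset.sum_congr rfl fun k _ => ?_
      rw [map_mul, mul_sub]
    rw [hsum]
    exact J.sum_mem fun k _ => J.mul_mem_left _ (hδ k)
  | algebraMap r₀ =>
    refine ⟨r₀, ?_⟩
    have : (⟨algebraMap R (Localization.Away t) r₀, Subalgebra.algebraMap_mem _ r₀⟩ : blowupAlgebra (maximalIdeal R) t) =
        algebraMap R (blowupAlgebra (maximalIdeal R) t) r₀ :=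
      Subtype.ext rfl
    rw [this, sub_self]
    exact J.zero_mem
  | add y z hy hz ihy ihz =>
    obtain ⟨r₁, h₁⟩ := ihy
    obtain ⟨r₂, h₂⟩ := ihz
    refine ⟨r₁ + r₂, ?_⟩
    have : (⟨y + z, add_mem hy hz⟩ : blowupAlgebra (maximalIdeal R) t) -
        algebraMap R (blowupAlgebra (maximalIdeal R) t) (r₁ + r₂) =
        ((⟨y, hy⟩ : blowupAlgebra (maximalIdeal R) t) - algebraMap R (blowupAlgebra (maximalIdeal R) t) r₁) +
          ((⟨z, hz⟩ : blowupAlgebra (maximalIdeal R) t) - algebraMap R (blowupAlgebra (maximalIdeal R) t) r₂) := by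
      rw [map_add]
      exact Subtype.ext (by push_cast; ring)
    rw [this]
    exact J.add_mem h₁ h₂
  | mul y z hy hz ihy ihz =>
    obtain ⟨r₁, h₁⟩ := ihy
    obtain ⟨r₂, h₂⟩ := ihz
    refine ⟨r₁ * r₂, ?_⟩
    have : (⟨y * z, mul_mem hy hz⟩ : blowupAlgebra (maximalIdeal R) t) -
        algebraMap R (blowupAlgebra (maximalIdeal R) t) (r₁ * r₂) =
        ((⟨y, hy⟩ : blowupAlgebra (maximalIdeal R) t) - algebraMap R (blowupAlgebra (maximalIdeal R) t) r₁) *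
            (⟨z, hz⟩ : blowupAlgebra (maximalIdeal R) t) +
          algebraMap R (blowupAlgebra (maximalIdeal R) t) r₁ *
            ((⟨z, hz⟩ : blowupAlgebra (maximalIdeal R) t) - algebraMap R (blowupAlgebra (maximalIdeal R) t) r₂) := by
      rw [map_mul]
      exact Subtype.ext (by push_cast; ring)
    rw [this]
    exact J.add_mem (J.mul_mem_right _ h₁) (J.mul_mem_left _ h₂)

include hspan ht in
/-- `𝔪 · R[𝔪/t] = t · R[𝔪/t] ⊆ J`: a scalar from `𝔪` lies in any ideal containing `t`. [cite: StacksProject, Tag 07Z3 (2)] -/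
theorem algebraMap_mem_of_mem_maximalIdeal (J : Ideal (blowupAlgebra (maximalIdeal R) t))
    (hJt : algebraMap R (blowupAlgebra (maximalIdeal R) t) t ∈ J) {r₀ : R} (hr₀ : r₀ ∈ maximalIdeal R) :
    algebraMap R (blowupAlgebra (maximalIdeal R) t) r₀ ∈ J := by
  have htm : t ∈ maximalIdeal R := by rw [← ht, ← hspan]; exact Ideal.subset_span ⟨j, rfl⟩
  have h := Ideal.mem_map_of_mem (algebraMap R (blowupAlgebra (maximalIdeal R) t)) hr₀
  rw [map_blowupAlgebra_eq_span htm] at h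
  have hle : Ideal.span {algebraMap R (blowupAlgebra (maximalIdeal R) t) t} ≤ J := by
    rw [Ideal.span_le, Set.singleton_subset_iff]; exact hJt
  exact hle h

include hspan ht in
/-- If `b ≡ r₀ (mod J)` with `r₀ ∈ 𝔪` then `b ∈ J`. [folklore] -/
theorem mem_of_sub_algebraMap_mem (J : Ideal (blowupAlgebra (maximalIdeal R) t))
    (hJt : algebraMap R (blowupAlgebra (maximalIdeal R) t) t ∈ J) {b : blowupAlgebra (maximalIdeal R) t} {r₀ : R}
    (hb : b - algebraMap R (blowupAlgebra (maximalIdeal R) t) r₀ ∈ J) (hr₀ : r₀ ∈ maximalIdeal R) : b ∈ J := by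
  have h := J.add_mem hb (algebraMap_mem_of_mem_maximalIdeal r hspan j ht J hJt hr₀)
  rwa [sub_add_cancel] at h

include hspan ht in
/-- **A proper ideal containing the point's equations is contained in any other ideal containing them.** [folklore] -/
theorem le_of_gens_mem {J J' : Ideal (blowupAlgebra (maximalIdeal R) t)} (hJ : J ≠ ⊤)
    (hJt : algebraMap R (blowupAlgebra (maximalIdeal R) t) t ∈ J)
    (hJg : ∀ k (hk : k ≠ j), (⟨_, div_mem_blowupAlgebra (maximalIdeal R) t (hr k hk)⟩ -
      algebraMap R (blowupAlgebra (maximalIdeal R) t) (at_ k) : blowupAlgebra (maximalIdeal R) t) ∈ J)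
    (hJ't : algebraMap R (blowupAlgebra (maximalIdeal R) t) t ∈ J')
    (hJ'g : ∀ k (hk : k ≠ j), (⟨_, div_mem_blowupAlgebra (maximalIdeal R) t (hr k hk)⟩ -
      algebraMap R (blowupAlgebra (maximalIdeal R) t) (at_ k) : blowupAlgebra (maximalIdeal R) t) ∈ J') :
    J ≤ J' := by
  intro b hb
  -- work modulo `J ⊓ J'`, which also contains the equations
  obtain ⟨r₀, hr₀⟩ := exists_sub_algebraMap_mem_of_gens_mem r hspan j ht hr at_ (J ⊓ J')
    (fun k hk => ⟨hJg k hk, hJ'g k hk⟩) b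
  by_cases hr₀m : r₀ ∈ maximalIdeal R
  · exact (mem_of_sub_algebraMap_mem r hspan j ht (J ⊓ J') ⟨hJt, hJ't⟩ hr₀ hr₀m).2
  · -- `r₀` is a unit, and `r₀ = b − (b − r₀) ∈ J`: contradiction with `J ≠ ⊤`
    exfalso
    have hu : IsUnit (algebraMap R (blowupAlgebra (maximalIdeal R) t) r₀) :=
      ((IsLocalRing.notMem_maximalIdeal.mp hr₀m)).map _
    have hmem : algebraMap R (blowupAlgebra (maximalIdeal R) t) r₀ ∈ J := by
      have h := J.sub_mem hb hr₀.1
      rwa [sub_sub_cancel] at h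
    exact hJ (Ideal.eq_top_of_isUnit_mem J hmem hu)

include hspan ht in
/-- **All proper ideals containing the point's equations coincide.** [folklore] -/
theorem eq_of_gens_mem {J J' : Ideal (blowupAlgebra (maximalIdeal R) t)} (hJ : J ≠ ⊤) (hJ' : J' ≠ ⊤)
    (hJt : algebraMap R (blowupAlgebra (maximalIdeal R) t) t ∈ J)
    (hJg : ∀ k (hk : k ≠ j), (⟨_, div_mem_blowupAlgebra (maximalIdeal R) t (hr k hk)⟩ -
      algebraMap R (blowupAlgebra (maximalIdeal R) t) (at_ k) : blowupAlgebra (maximalIdeal R) t) ∈ J)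
    (hJ't : algebraMap R (blowupAlgebra (maximalIdeal R) t) t ∈ J')
    (hJ'g : ∀ k (hk : k ≠ j), (⟨_, div_mem_blowupAlgebra (maximalIdeal R) t (hr k hk)⟩ -
      algebraMap R (blowupAlgebra (maximalIdeal R) t) (at_ k) : blowupAlgebra (maximalIdeal R) t) ∈ J') :
    J = J' :=
  le_antisymm (le_of_gens_mem r hspan j ht hr at_ hJ hJt hJg hJ't hJ'g)
    (le_of_gens_mem r hspan j ht hr at_ hJ' hJ't hJ'g hJt hJg)

include hspan ht in
/-- **A proper ideal containing the point's equations is MAXIMAL** (`B/J` is a quotient of the residue field `R/𝔪`). [folklore] -/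
theorem isMaximal_of_gens_mem {J : Ideal (blowupAlgebra (maximalIdeal R) t)} (hJ : J ≠ ⊤)
    (hJt : algebraMap R (blowupAlgebra (maximalIdeal R) t) t ∈ J)
    (hJg : ∀ k (hk : k ≠ j), (⟨_, div_mem_blowupAlgebra (maximalIdeal R) t (hr k hk)⟩ -
      algebraMap R (blowupAlgebra (maximalIdeal R) t) (at_ k) : blowupAlgebra (maximalIdeal R) t) ∈ J) :
    J.IsMaximal := by
  refine ⟨⟨hJ, fun J' hJJ' => ?_⟩⟩
  by_contra hJ'
  have hle : J' ≤ J := le_of_gens_mem r hspan j ht hr at_ hJ' (hJJ'.le hJt) (fun k hk => hJJ'.le (hJg k hk)) hJt hJg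
  exact hJJ'.ne (le_antisymm hJJ'.le hle)

end Point

/-! ### §2. The frame's point: res-type-071's maximal ideal IS lead-1's `stepPrime` (`d = 4`, `j = 0`) -/

section StepPrime

variable {κ : Type u} [Field κ] {R : Type u} [CommRing R] [IsLocalRing R] {t : R} {ψ : R →+* MvPowerSeries (Fin 4) κ}
  [IsLocalHom ψ] (c : Fin 4 → κ) (hψt : ψ t = X 0)

/-- **POINT MATCHING, closed form.** If `𝔪_R = (r_0, r_1, r_2, r_3)` with `r 0 = t`, the frame `ψ` has `ψ (r i) ≡ y_i + λ_i t (mod 𝔪²)`,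
and the constants are `c_i = res(ψ ã_i) − λ_i`, then ANY PROPER ideal `𝔑` of `R[𝔪/t]` containing `t` and the `r_i/t − ã_i`
(`i ≠ 0`) — e.g. res-type-071's maximal ideal of `EmbeddedStep.exists_maximalIdeal_presentation` — IS `stepPrime c hψt`
(`t_mem_stepPrime`, `span_le_stepPrime` + `eq_of_gens_mem`; no residue-surjectivity of `ψ` needed). [folklore] -/
theorem stepPrime_eq_of_gens_mem {r : Fin 4 → R} (hr0 : r 0 = t) (hspan : Ideal.span (Set.range r) = maximalIdeal R)
    (hr : ∀ i, i ≠ 0 → r i ∈ maximalIdeal R) {lam : Fin 4 → κ}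
    (hψr : ∀ i, i ≠ 0 → ψ (r i) - X i - C (lam i) * X 0 ∈ maximalIdeal (MvPowerSeries (Fin 4) κ) ^ 2) (at_ : Fin 4 → R)
    (hc : ∀ i, i ≠ 0 → c i = constantCoeff (ψ (at_ i)) - lam i)
    {𝔑 : Ideal (blowupAlgebra (maximalIdeal R) t)} (h𝔑 : 𝔑 ≠ ⊤)
    (h𝔑t : algebraMap R (blowupAlgebra (maximalIdeal R) t) t ∈ 𝔑)
    (h𝔑g : ∀ i (hi : i ≠ 0), (⟨_, div_mem_blowupAlgebra (maximalIdeal R) t (hr i hi)⟩ -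
      algebraMap R (blowupAlgebra (maximalIdeal R) t) (at_ i) : blowupAlgebra (maximalIdeal R) t) ∈ 𝔑) :
    𝔑 = stepPrime c hψt :=
  eq_of_gens_mem r hspan 0 hr0 hr at_ h𝔑 (Ideal.IsPrime.ne_top inferInstance) h𝔑t h𝔑g (t_mem_stepPrime c hψt)
    (span_le_stepPrime c hψt hr hψr at_ hc)

/-- The same with `𝔑` given as a maximal ideal (the shape of res-type-071's socket). [folklore] -/
theorem stepPrime_eq_of_isMaximal {r : Fin 4 → R} (hr0 : r 0 = t) (hspan : Ideal.span (Set.range r) = maximalIdeal R)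
    (hr : ∀ i, i ≠ 0 → r i ∈ maximalIdeal R) {lam : Fin 4 → κ}
    (hψr : ∀ i, i ≠ 0 → ψ (r i) - X i - C (lam i) * X 0 ∈ maximalIdeal (MvPowerSeries (Fin 4) κ) ^ 2) (at_ : Fin 4 → R)
    (hc : ∀ i, i ≠ 0 → c i = constantCoeff (ψ (at_ i)) - lam i)
    {𝔑 : Ideal (blowupAlgebra (maximalIdeal R) t)} (h𝔑 : 𝔑.IsMaximal)
    (h𝔑t : algebraMap R (blowupAlgebra (maximalIdeal R) t) t ∈ 𝔑)
    (h𝔑g : ∀ i (hi : i ≠ 0), (⟨_, div_mem_blowupAlgebra (maximalIdeal R) t (hr i hi)⟩ -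
      algebraMap R (blowupAlgebra (maximalIdeal R) t) (at_ i) : blowupAlgebra (maximalIdeal R) t) ∈ 𝔑) :
    𝔑 = stepPrime c hψt :=
  stepPrime_eq_of_gens_mem c hψt hr0 hspan hr hψr at_ hc h𝔑.ne_top h𝔑t h𝔑g

/-- **`stepPrime` is maximal WITHOUT residue surjectivity**, as soon as `𝔪_R = (t, r_1, r_2, r_3)` (compare
`stepPrime_isMaximal`). [folklore] -/
theorem stepPrime_isMaximal_of_span {r : Fin 4 → R} (hr0 : r 0 = t) (hspan : Ideal.span (Set.range r) = maximalIdeal R)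
    (hr : ∀ i, i ≠ 0 → r i ∈ maximalIdeal R) {lam : Fin 4 → κ}
    (hψr : ∀ i, i ≠ 0 → ψ (r i) - X i - C (lam i) * X 0 ∈ maximalIdeal (MvPowerSeries (Fin 4) κ) ^ 2) (at_ : Fin 4 → R)
    (hc : ∀ i, i ≠ 0 → c i = constantCoeff (ψ (at_ i)) - lam i) :
    (stepPrime c hψt).IsMaximal :=
  isMaximal_of_gens_mem r hspan 0 hr0 hr at_ (Ideal.IsPrime.ne_top inferInstance) (t_mem_stepPrime c hψt)
    (span_le_stepPrime c hψt hr hψr at_ hc)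

/-- **Instance transport**: a localisation of `R[𝔪/t]` at res-type-071's `𝔑` is a localisation at `stepPrime c hψt` once
`𝔑 = stepPrime c hψt`, so that `FormalFrame.stepFrame c hψt R′` and its lemmas apply to the tower's ring `R′`. [folklore] -/
theorem isLocalizationAtPrime_stepPrime_of_eq (R' : Type u) [CommRing R'] [Algebra (blowupAlgebra (maximalIdeal R) t) R']
    {𝔑 : Ideal (blowupAlgebra (maximalIdeal R) t)} [𝔑.IsPrime] [h : IsLocalization.AtPrime R' 𝔑]
    (he : 𝔑 = stepPrime c hψt) : IsLocalization.AtPrime R' (stepPrime c hψt) := by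
  subst he
  exact h

end StepPrime

end FormalFrame

end Summit.ResolutionOfSingularities.ResolutionOfSingularities.Cruxes.SigmaMaxModifications.IdeasL1C5

end
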